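import Summits.Ventures.HSemireg.ContractionSpanAlgebra
import Mathlib.LinearAlgebra.Dual.Lemmas
import Mathlib.Algebra.BigOperators.Intervals
import Mathlib.Data.Nat.Choose.Basic
import Mathlib.Order.Interval.Finset.Fin
import HarnessLib

/-!
# Venture HSemireg — the contraction block of a top form and the point-ideal rank theorem
# (`dim contractionSpan L L^⊥ (a·1 + b·ω) = 2·C(n, 2)` for `dim V = 2n`, `dim L = n`, `n ≥ 3`; th-7's T_lin)

HONEST FRAMING. Pure linear algebra continuing `ContractionSpanAlgebra.lean` (seat p4 of the computation cell
`pub-hsemireg`; statement sheet `theory/FORMULA-N-th7.md` §N.2). Nothing here is a claim about any variety and nothing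
here says that HC / HC_CM / HC_AV holds. Everything is PROVED; no named fact.

Contents: for a finite-dimensional `V`, a subspace `L` with `Θ = {θ : θ|_L = 0}` and `ω ≠ 0` with `v ∧ ω = 0` for all
`v` (a TOP form), the contraction block `span{ι_{θ₁} ι_{θ₂} ω : θᵢ ∈ Θ}` has dimension `C(dim V - dim L, 2)`
(`finrank_contractBlock`, by the dual-functional identity `k' ∧ k ∧ ι_{θ₁} ι_{θ₂} ω = det(θᵢ(kⱼ))·ω` of the first
file); the counting lemma `card {i < j in Fin r} = C(r, 2)`; top-degree vanishing `Λ^{>dim V} V = 0`; and the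
assembled POINT-IDEAL RANK THEOREM `finrank_span_pointIdeal` (degrees `2 ≠ 2n - 2` separate the two blocks for
`n ≥ 3`: dimension `2·C(n, 2)`), and the coincidence case `finrank_span_pointIdeal_two` (`n = 2`: the contraction
block LIES IN the `Λ²`-block, dimension `1`; explicit top form `c·k₀ ∧ k₁ ∧ l₀ ∧ l₁`). So th-7's `r₂(n) = [t²]P_n` is a
tree theorem for every `n ≥ 2`. References: [BourbakiAlgebre1a3] Ch. III §7–§8, §11 no. 9.
-/

noncomputable section

open CliffordAlgebra (contractLeft)
open ExteriorAlgebra (ι)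
open Module

namespace Summit.Ventures.HSemireg

namespace ContractionSpan

section Field

variable {K : Type*} [Field K] {V : Type*} [AddCommGroup V] [Module K V]

/-! ### 1. Counting: `#{(i, j) : i < j} = C(r, 2)` -/

/-- The increasing pairs in `Fin r`. [folklore] -/
abbrev IncPair (r : ℕ) : Type := {p : Fin r × Fin r // p.1 < p.2}

/-- `#{(i, j) ∈ Fin r × Fin r : i < j} = C(r, 2)`. [folklore] -/
theorem card_incPair (r : ℕ) : Fintype.card (IncPair r) = r.choose 2 := by
  classical
  -- `IncPair r ≃ Σ j, {i // i < j}`, then count fibres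
  let e : IncPair r ≃ Σ j : Fin r, {i : Fin r // i < j} :=
    { toFun := fun p => ⟨p.1.2, ⟨p.1.1, p.2⟩⟩
      invFun := fun q => ⟨(q.2.1, q.1), q.2.2⟩
      left_inv := fun p => rfl
      right_inv := fun q => rfl }
  rw [Fintype.card_congr e, Fintype.card_sigma]
  have hfib : ∀ j : Fin r, Fintype.card {i : Fin r // i < j} = (j : ℕ) := fun j => by
    rw [Fintype.card_subtype, ← Fin.card_Iio j]
    congr 1
    ext i
    simp
  simp_rw [hfib]
  rw [Fin.sum_univ_eq_sum_range (fun i => i) r, Finset.sum_range_id, Nat.choose_two_right]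

/-! ### 2. Top-degree vanishing -/

/-- `Λᵐ V = 0` for `m > dim V` (the exterior powers of a finite-dimensional space vanish above the dimension:
`dim Λᵐ V = C(dim V, m) = 0`). [cite: BourbakiAlgebre1a3, Ch. III §7 no. 8 (Thm. 1 and Cor.)] -/
theorem exteriorPower_eq_bot_of_finrank_lt [FiniteDimensional K V] {m : ℕ} (hm : Module.finrank K V < m) :
    (⋀[K]^m V) = ⊥ := by
  rw [← Submodule.finrank_eq_zero, exteriorPower.finrank_eq, Nat.choose_eq_zero_of_lt hm]

/-- A form of top degree is killed by every vector: `v ∧ ω = 0` for `ω ∈ Λ^{dim V} V`.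
[cite: BourbakiAlgebre1a3, Ch. III §7 no. 8] -/
theorem ι_mul_eq_zero_of_mem_top [FiniteDimensional K V] {d : ℕ} (hd : Module.finrank K V = d)
    {ω : ExteriorAlgebra K V} (hω : ω ∈ ⋀[K]^d V) (v : V) : ι K v * ω = 0 := by
  have h := ι_mul_mem_succ (K := K) v hω
  rw [exteriorPower_eq_bot_of_finrank_lt (by omega : Module.finrank K V < d + 1), Submodule.mem_bot] at h
  exact h

/-! ### 3. The contraction block of a top form has dimension `C(dim V - dim L, 2)` -/

section ContractBlock

variable [FiniteDimensional K V] (L C : Submodule K V) (hLC : IsCompl L C)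

/-- The coordinate forms of a basis of a complement `C` of `L`, extended by `0` on `L`: `θⱼ := bⱼ* ∘ pr_C`.
[cite: BourbakiAlgebre1a3, Ch. II §7 no. 5 (dual bases)] -/
def coordForm (j : Fin (Module.finrank K C)) : Module.Dual K V :=
  ((Module.finBasis K C).coord j) ∘ₗ Submodule.projectionOnto C L hLC.symm

/-- `θᵢ(kⱼ) = δᵢⱼ` on the basis vectors `kⱼ` of the complement. [cite: BourbakiAlgebre1a3, Ch. II §7 no. 5] -/
theorem coordForm_basis (i j : Fin (Module.finrank K C)) :
    coordForm L C hLC i ((Module.finBasis K C j : C) : V) = if i = j then 1 else 0 := by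
  rw [coordForm, LinearMap.comp_apply, Submodule.projectionOnto_apply_left, Module.Basis.coord_apply,
    Module.Basis.repr_self, Finsupp.single_apply]
  simp only [eq_comm]

/-- The coordinate forms kill `L`. [cite: BourbakiAlgebre1a3, Ch. II §7 no. 5] -/
theorem coordForm_apply_of_mem (i : Fin (Module.finrank K C)) {q : V} (hq : q ∈ L) : coordForm L C hLC i q = 0 := by
  rw [coordForm, LinearMap.comp_apply]
  have : Submodule.projectionOnto C L hLC.symm q = 0 := Submodule.projectionOnto_apply_right hLC.symm ⟨q, hq⟩
  rw [this, map_zero]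

/-- **A form killing `L` is the combination `Σⱼ θ(kⱼ)·θⱼ` of the coordinate forms.**
[cite: BourbakiAlgebre1a3, Ch. II §7 no. 5] -/
theorem eq_sum_coordForm {θ : Module.Dual K V} (hθ : ∀ q ∈ L, θ q = 0) :
    θ = ∑ j, θ ((Module.finBasis K C j : C) : V) • coordForm L C hLC j := by
  apply LinearMap.ext
  intro v
  have hv := Submodule.projection_add_projection_eq_self hLC v
  set c : C := Submodule.projectionOnto C L hLC.symm v with hc
  have hθv : θ v = θ (c : V) := by
    conv_lhs => rw [← hv]
    rw [map_add, Submodule.projection_apply, hθ _ (Submodule.coe_mem _), zero_add, Submodule.projection_apply]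
  have hcsum : (c : V) = ∑ j, (Module.finBasis K C).repr c j • ((Module.finBasis K C j : C) : V) := by
    conv_lhs => rw [← (Module.finBasis K C).sum_repr c]
    rw [Submodule.coe_sum]
    rfl
  rw [hθv, hcsum, map_sum, LinearMap.sum_apply]
  refine Finset.sum_congr rfl fun j _ => ?_
  rw [map_smul, LinearMap.smul_apply, smul_eq_mul, smul_eq_mul, mul_comm, coordForm, LinearMap.comp_apply,
    Module.Basis.coord_apply]

/-- The family `y_(i,j) := ι_{θᵢ} ι_{θⱼ} ω`, `i < j`, of double contractions of `ω` by coordinate forms.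
[cite: BourbakiAlgebre1a3, Ch. III §11 no. 9] -/
def contractPair (ω : ExteriorAlgebra K V) (p : IncPair (Module.finrank K C)) : ExteriorAlgebra K V :=
  contractLeft (coordForm L C hLC p.1.1) (contractLeft (coordForm L C hLC p.1.2) ω)

omit [FiniteDimensional K V] in
/-- Expansion of a double contraction along the coordinate forms:
`ι_{Σ cᵢ θᵢ} ι_{Σ dⱼ θⱼ} ω = Σᵢ cᵢ Σⱼ dⱼ ι_{θᵢ} ι_{θⱼ} ω`. [cite: BourbakiAlgebre1a3, Ch. III §11 no. 9] -/
theorem contractLeft_sum_contractLeft_sum {ι' : Type*} (s : Finset ι') (c d : ι' → K) (θ : ι' → Module.Dual K V)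
    (ω : ExteriorAlgebra K V) :
    contractLeft (∑ i ∈ s, c i • θ i) (contractLeft (∑ j ∈ s, d j • θ j) ω) =
      ∑ i ∈ s, c i • ∑ j ∈ s, d j • contractLeft (θ i) (contractLeft (θ j) ω) := by
  rw [map_sum, LinearMap.sum_apply]
  refine Finset.sum_congr rfl fun i _ => ?_
  rw [map_smul, LinearMap.smul_apply, map_sum, LinearMap.sum_apply, map_sum]
  congr 1
  refine Finset.sum_congr rfl fun j _ => ?_
  rw [map_smul, LinearMap.smul_apply, map_smul]

/-- **The contraction block is spanned by the `y_(i,j)`, `i < j`** (bilinearity of `(θ₁, θ₂) ↦ ι_{θ₁} ι_{θ₂} ω`,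
`ι_θ ι_θ = 0`, `ι_{θ₁} ι_{θ₂} = -ι_{θ₂} ι_{θ₁}`, and `eq_sum_coordForm`).
[cite: BourbakiAlgebre1a3, Ch. III §11 no. 9] -/
theorem contractBlock_eq_span_contractPair (ω : ExteriorAlgebra K V) :
    contractBlock {θ : Module.Dual K V | ∀ q ∈ L, θ q = 0} ω =
      Submodule.span K (Set.range (contractPair L C hLC ω)) := by
  apply le_antisymm
  · refine Submodule.span_le.mpr ?_
    rintro y ⟨θ₁, hθ₁, θ₂, hθ₂, rfl⟩
    rw [eq_sum_coordForm L C hLC hθ₁, eq_sum_coordForm L C hLC hθ₂, contractLeft_sum_contractLeft_sum]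
    refine Submodule.sum_mem _ fun i _ => Submodule.smul_mem _ _ (Submodule.sum_mem _ fun j _ =>
      Submodule.smul_mem _ _ ?_)
    rcases lt_trichotomy i j with hij | rfl | hji
    · exact Submodule.subset_span ⟨⟨(i, j), hij⟩, rfl⟩
    · rw [CliffordAlgebra.contractLeft_contractLeft]; exact Submodule.zero_mem _
    · rw [CliffordAlgebra.contractLeft_comm]
      exact Submodule.neg_mem _ (Submodule.subset_span ⟨⟨(j, i), hji⟩, rfl⟩)
  · refine Submodule.span_le.mpr ?_
    rintro y ⟨p, rfl⟩
    exact Submodule.subset_span ⟨_, fun q hq => coordForm_apply_of_mem L C hLC _ hq, _,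
      fun q hq => coordForm_apply_of_mem L C hLC _ hq, rfl⟩

/-- The Kronecker scalar of the dual-functional test on increasing pairs. [folklore] -/
theorem pairTest_eq {r : ℕ} (p p₀ : IncPair r) :
    ((if p.1.1 = p₀.1.1 then (1 : K) else 0) * (if p.1.2 = p₀.1.2 then 1 else 0) -
        (if p.1.2 = p₀.1.1 then (1 : K) else 0) * (if p.1.1 = p₀.1.2 then 1 else 0)) =
      if p = p₀ then 1 else 0 := by
  obtain ⟨⟨i, j⟩, hij⟩ := p
  obtain ⟨⟨i₀, j₀⟩, h₀⟩ := p₀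
  have hcross : (if j = i₀ then (1 : K) else 0) * (if i = j₀ then 1 else 0) = 0 := by
    split_ifs with h1 h2
    · subst h1; subst h2; exact absurd (hij.trans h₀) (lt_irrefl _)
    all_goals simp
  rw [hcross, sub_zero]
  by_cases h : (⟨(i, j), hij⟩ : IncPair r) = ⟨(i₀, j₀), h₀⟩
  · rw [if_pos h]
    simp only [Subtype.mk.injEq, Prod.mk.injEq] at h
    rw [if_pos h.1, if_pos h.2, mul_one]
  · rw [if_neg h]
    simp only [Subtype.mk.injEq, Prod.mk.injEq, not_and_or] at h
    rcases h with h | h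
    · rw [if_neg h, zero_mul]
    · rw [if_neg h, mul_zero]

/-- The dual-functional test: `k_{j₀} ∧ k_{i₀} ∧ y_(i,j) = [(i,j) = (i₀,j₀)]·ω` for a top form `ω`.
[cite: BourbakiAlgebre1a3, Ch. III §11 no. 9] -/
theorem test_contractPair {ω : ExteriorAlgebra K V} (hVω : ∀ v : V, ι K v * ω = 0)
    (p p₀ : IncPair (Module.finrank K C)) :
    ι K ((Module.finBasis K C p₀.1.2 : C) : V) *
        (ι K ((Module.finBasis K C p₀.1.1 : C) : V) * contractPair L C hLC ω p) =
      (if p = p₀ then (1 : K) else 0) • ω := by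
  rw [contractPair, ι_mul_ι_mul_contractLeft_contractLeft (hVω _) (hVω _), coordForm_basis, coordForm_basis,
    coordForm_basis, coordForm_basis, pairTest_eq]

/-- **The `y_(i,j)` are linearly independent** for a top form `ω ≠ 0`.
[cite: BourbakiAlgebre1a3, Ch. III §11 no. 9] -/
theorem linearIndependent_contractPair {ω : ExteriorAlgebra K V} (hVω : ∀ v : V, ι K v * ω = 0) (hω0 : ω ≠ 0) :
    LinearIndependent K (contractPair L C hLC ω) := by
  classical
  rw [linearIndependent_iff']
  intro s g hg p₀ hp₀
  -- apply the linear functional `z ↦ k_{j₀} ∧ k_{i₀} ∧ z`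
  have h := congrArg (fun z => ι K ((Module.finBasis K C p₀.1.2 : C) : V) *
    (ι K ((Module.finBasis K C p₀.1.1 : C) : V) * z)) hg
  simp only [Finset.mul_sum, mul_smul_comm, mul_zero, test_contractPair L C hLC hVω, smul_ite, smul_zero,
    one_smul, ite_smul, zero_smul, Finset.sum_ite_eq', hp₀, if_true] at h
  exact (smul_eq_zero.mp h).resolve_right hω0

/-- **`dim` contraction block `= C(dim C, 2)`** for a top form `ω ≠ 0`, `Θ = L^⊥`, `C` a complement of `L`.
[cite: BourbakiAlgebre1a3, Ch. III §11 no. 9] -/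
theorem finrank_contractBlock_of_isCompl (hLC : IsCompl L C) {ω : ExteriorAlgebra K V}
    (hVω : ∀ v : V, ι K v * ω = 0) (hω0 : ω ≠ 0) :
    Module.finrank K (contractBlock {θ : Module.Dual K V | ∀ q ∈ L, θ q = 0} ω) = (Module.finrank K C).choose 2 := by
  rw [contractBlock_eq_span_contractPair L C hLC,
    finrank_span_eq_card (linearIndependent_contractPair L C hLC hVω hω0),
    card_incPair]

end ContractBlock

/-- **`dim` contraction block `= C(dim V - dim L, 2)`** for a top form `ω ≠ 0` and `Θ = {θ : θ|_L = 0}`.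
[cite: BourbakiAlgebre1a3, Ch. III §11 no. 9] -/
theorem finrank_contractBlock [FiniteDimensional K V] (L : Submodule K V) {ω : ExteriorAlgebra K V}
    (hVω : ∀ v : V, ι K v * ω = 0) (hω0 : ω ≠ 0) :
    Module.finrank K (contractBlock {θ : Module.Dual K V | ∀ q ∈ L, θ q = 0} ω) =
      (Module.finrank K V - Module.finrank K L).choose 2 := by
  obtain ⟨C, hLC⟩ := L.exists_isCompl
  rw [finrank_contractBlock_of_isCompl L C hLC hVω hω0, ← Submodule.finrank_add_eq_of_isCompl hLC,
    Nat.add_sub_cancel_left]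

/-! ### 4. The point-ideal rank theorem -/

/-- Distinct graded pieces of `Λ V` are disjoint (the grading is an internal direct sum).
[cite: BourbakiAlgebre1a3, Ch. III §7 no. 1] -/
theorem disjoint_exteriorPower {i j : ℕ} (hij : i ≠ j) : Disjoint (⋀[K]^i V) (⋀[K]^j V) :=
  (DirectSum.Decomposition.isInternal (fun n : ℕ => ⋀[K]^n V)).submodule_iSupIndep.pairwiseDisjoint hij

/-- **T_lin (th-7, FORMULA-N §N.2), `n ≥ 3`.** Let `dim V = 2n`, `L ⊆ V` a subspace of dimension `n`,
`Θ = {θ : θ|_L = 0}`, `ω ≠ 0` of top degree `2n`, and `a, b ≠ 0`. Then the polyvector contraction span of the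
point-ideal class `x = a·1 + b·ω` has dimension `2·C(n, 2)`: it is `Λ²`-block `⊕` contraction block
(`span_algebraMap_add_smul`; the blocks lie in degrees `2 ≠ 2n - 2`), of dimensions `C(n, 2)` each
(`finrank_wedgeBlock`, `finrank_contractBlock`). [cite: BourbakiAlgebre1a3, Ch. III §7 no. 8 and §11 no. 9] -/
theorem finrank_span_pointIdeal [FiniteDimensional K V] {n : ℕ} (hV : Module.finrank K V = 2 * n)
    (L : Submodule K V) (hL : Module.finrank K L = n) {ω : ExteriorAlgebra K V} (hω : ω ∈ ⋀[K]^(2 * n) V)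
    (hω0 : ω ≠ 0) {a b : K} (ha : a ≠ 0) (hb : b ≠ 0) (hn : 3 ≤ n) :
    Module.finrank K (span (L : Set V) {θ : Module.Dual K V | ∀ q ∈ L, θ q = 0} (algebraMap K _ a + b • ω)) =
      2 * n.choose 2 := by
  have hVω : ∀ v : V, ι K v * ω = 0 := ι_mul_eq_zero_of_mem_top hV hω
  rw [span_algebraMap_add_smul (L := (L : Set V)) (Θ := {θ : Module.Dual K V | ∀ q ∈ L, θ q = 0})
    (fun θ hθ q hq => hθ q hq) (fun q _ => hVω q) (Ne.isUnit ha) (Ne.isUnit hb)]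
  -- the two blocks are disjoint (degrees 2 and 2n - 2) and finite-dimensional
  have hW : wedgeBlock (K := K) (L : Set V) ≤ ⋀[K]^2 V := wedgeBlock_le _
  have hC : contractBlock {θ : Module.Dual K V | ∀ q ∈ L, θ q = 0} ω ≤ ⋀[K]^(2 * n - 2) V := contractBlock_le _ hω
  haveI : FiniteDimensional K (wedgeBlock (K := K) (L : Set V)) := Submodule.finiteDimensional_of_le hW
  haveI : FiniteDimensional K (contractBlock {θ : Module.Dual K V | ∀ q ∈ L, θ q = 0} ω) :=
    Submodule.finiteDimensional_of_le hC
  have hdisj : wedgeBlock (K := K) (L : Set V) ⊓ contractBlock {θ : Module.Dual K V | ∀ q ∈ L, θ q = 0} ω = ⊥ :=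
    disjoint_iff.mp ((disjoint_exteriorPower (K := K) (V := V) (by omega : 2 ≠ 2 * n - 2)).mono hW hC)
  have hsum := Submodule.finrank_sup_add_finrank_inf_eq (wedgeBlock (K := K) (L : Set V))
    (contractBlock {θ : Module.Dual K V | ∀ q ∈ L, θ q = 0} ω)
  rw [hdisj, finrank_bot, add_zero, finrank_wedgeBlock, finrank_contractBlock L hVω hω0, hV, hL,
    show 2 * n - n = n by omega] at hsum
  omega

/-! ### 5. The case `n = 2`: both blocks are the line `Λ² L`, the span has dimension `1` -/

section Two

variable [FiniteDimensional K V]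

/-- In an increasing pair of `Fin 2`-type indices the entries are `0` and `1`. [folklore] -/
theorem incPair_eq_of_two {r : ℕ} (hr : r = 2) (p : IncPair r) :
    (p.1.1 : ℕ) = 0 ∧ (p.1.2 : ℕ) = 1 := by
  obtain ⟨⟨i, j⟩, hij⟩ := p
  have hi := i.isLt; have hj := j.isLt
  have hij' : (i : ℕ) < j := hij
  simp only
  omega

/-- **`n = 2`: the contraction block of a top form lies in the `Λ²`-block of `L`** (`dim V = 4`, `dim L = dim C = 2`):
with adapted bases `k₀, k₁` of `C`, `l₀, l₁` of `L`, the top form is `ω = c·k₀ ∧ k₁ ∧ l₀ ∧ l₁` and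
`ι_{θ₀} ι_{θ₁} ω = -c·l₀ ∧ l₁`. [cite: BourbakiAlgebre1a3, Ch. III §7 no. 8 and §11 no. 9] -/
theorem contractBlock_le_wedgeBlock_of_two (L C : Submodule K V) (hLC : IsCompl L C) (hV : Module.finrank K V = 4)
    (hL : Module.finrank K L = 2) {ω : ExteriorAlgebra K V} (hω : ω ∈ ⋀[K]^4 V) :
    contractBlock {θ : Module.Dual K V | ∀ q ∈ L, θ q = 0} ω ≤ wedgeBlock (K := K) (L : Set V) := by
  have hC : Module.finrank K C = 2 := by
    have := Submodule.finrank_add_eq_of_isCompl hLC; omega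
  -- the two indices of each basis
  set i₀ : Fin (Module.finrank K C) := ⟨0, by omega⟩
  set i₁ : Fin (Module.finrank K C) := ⟨1, by omega⟩
  set j₀ : Fin (Module.finrank K L) := ⟨0, by omega⟩
  set j₁ : Fin (Module.finrank K L) := ⟨1, by omega⟩
  have hi : i₀ ≠ i₁ := by simp [i₀, i₁, Fin.ext_iff]
  have hj : j₀ ≠ j₁ := by simp [j₀, j₁, Fin.ext_iff]
  set k : Fin (Module.finrank K C) → V := fun i => ((Module.finBasis K C i : C) : V)
  set l : Fin (Module.finrank K L) → V := fun j => ((Module.finBasis K L j : L) : V)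
  set θ := coordForm L C hLC
  set lam := coordForm C L hLC.symm
  have hθk : ∀ a b, θ a (k b) = if a = b then 1 else 0 := coordForm_basis L C hLC
  have hθl : ∀ a b, θ a (l b) = 0 := fun a b => coordForm_apply_of_mem L C hLC a (Submodule.coe_mem _)
  have hlaml : ∀ a b, lam a (l b) = if a = b then 1 else 0 := coordForm_basis C L hLC.symm
  -- the full monomial and its double contraction
  set M : ExteriorAlgebra K V := ι K (k i₀) * (ι K (k i₁) * (ι K (l j₀) * ι K (l j₁))) with hM
  have hll : ∀ a, contractLeft (θ a) (ι K (l j₀) * ι K (l j₁)) = 0 := fun a => by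
    rw [CliffordAlgebra.contractLeft_ι_mul, hθl, zero_smul, CliffordAlgebra.contractLeft_ι, hθl, map_zero, mul_zero,
      sub_zero]
  have hθM : contractLeft (θ i₀) (contractLeft (θ i₁) M) = -(ι K (l j₀) * ι K (l j₁)) := by
    rw [hM, CliffordAlgebra.contractLeft_ι_mul, hθk, if_neg (Ne.symm hi), zero_smul, zero_sub,
      CliffordAlgebra.contractLeft_ι_mul, hθk, if_pos rfl, one_smul, hll, mul_zero, sub_zero, map_neg,
      CliffordAlgebra.contractLeft_ι_mul, hθk, if_pos rfl, one_smul, hll, mul_zero, sub_zero]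
  -- `M ≠ 0`: contract further by the forms dual to `l₀, l₁`
  have hM0 : M ≠ 0 := by
    intro h0
    have h1 := congrArg (fun z => contractLeft (lam j₁) (contractLeft (lam j₀)
      (contractLeft (θ i₀) (contractLeft (θ i₁) z)))) h0
    simp only [map_zero] at h1
    rw [hθM, map_neg, map_neg, contractLeft_contractLeft_ι_mul_ι, hlaml, hlaml, hlaml, hlaml, if_pos rfl, if_pos rfl,
      if_neg hj, if_neg (Ne.symm hj), neg_eq_zero] at h1
    have h2 := (ExteriorAlgebra.algebraMap_leftInverse (R := K) V).injective (h1.trans (map_zero _).symm)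
    norm_num at h2
  -- `Λ⁴ V` is the line through `M`, so `ω = c·M`
  have hMmem : M ∈ ⋀[K]^4 V := by
    rw [hM, show (4 : ℕ) = 1 + (1 + (1 + 1)) by rfl, ExteriorAlgebra.exteriorPower, pow_add, pow_add, pow_add, pow_one]
    exact Submodule.mul_mem_mul (LinearMap.mem_range_self _ _) (Submodule.mul_mem_mul (LinearMap.mem_range_self _ _)
      (Submodule.mul_mem_mul (LinearMap.mem_range_self _ _) (LinearMap.mem_range_self _ _)))
  have htop : (⋀[K]^4 V) = K ∙ M := by
    refine (Submodule.eq_of_le_of_finrank_eq ((Submodule.span_singleton_le_iff_mem _ _).mpr hMmem) ?_).symm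
    rw [finrank_span_singleton hM0, exteriorPower.finrank_eq, hV, Nat.choose_self]
  obtain ⟨c, rfl⟩ : ∃ c : K, c • M = ω := by
    rw [← Submodule.mem_span_singleton, ← htop]; exact hω
  -- every generator of the contraction block is the pair `(i₀, i₁)` applied to `c·M`
  rw [contractBlock_eq_span_contractPair L C hLC]
  refine Submodule.span_le.mpr ?_
  rintro y ⟨p, rfl⟩
  obtain ⟨hp0, hp1⟩ := incPair_eq_of_two hC p
  have hp : p.1.1 = i₀ ∧ p.1.2 = i₁ := ⟨Fin.ext hp0, Fin.ext hp1⟩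
  rw [contractPair, hp.1, hp.2, map_smul, map_smul, hθM, smul_neg]
  exact Submodule.neg_mem _ (Submodule.smul_mem _ c
    (Submodule.subset_span ⟨l j₀, Submodule.coe_mem _, l j₁, Submodule.coe_mem _, rfl⟩))

end Two

/-- **T_lin, `n = 2`** (`dim V = 4`, `dim L = 2`): the contraction span of the point-ideal class `a·1 + b·ω`, `ω` of
top degree (zero or not), is the LINE `Λ² L` — dimension `1 = C(2,2)`, NOT `2·C(2,2)`: the contraction block lies in
the `Λ²`-block (th-7 §N.2 (iv)). [cite: BourbakiAlgebre1a3, Ch. III §7 no. 8 and §11 no. 9] -/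
theorem finrank_span_pointIdeal_two [FiniteDimensional K V] (hV : Module.finrank K V = 4) (L : Submodule K V)
    (hL : Module.finrank K L = 2) {ω : ExteriorAlgebra K V} (hω : ω ∈ ⋀[K]^4 V) {a b : K} (ha : a ≠ 0)
    (hb : b ≠ 0) :
    Module.finrank K (span (L : Set V) {θ : Module.Dual K V | ∀ q ∈ L, θ q = 0} (algebraMap K _ a + b • ω)) = 1 := by
  have hVω : ∀ v : V, ι K v * ω = 0 := ι_mul_eq_zero_of_mem_top hV hω
  obtain ⟨C, hLC⟩ := L.exists_isCompl
  rw [span_algebraMap_add_smul (L := (L : Set V)) (Θ := {θ : Module.Dual K V | ∀ q ∈ L, θ q = 0})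
    (fun θ hθ q hq => hθ q hq) (fun q _ => hVω q) (Ne.isUnit ha) (Ne.isUnit hb),
    sup_eq_left.mpr (contractBlock_le_wedgeBlock_of_two L C hLC hV hL hω), finrank_wedgeBlock, hL]
  rfl

end Field

end ContractionSpan

end Summit.Ventures.HSemireg

end
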